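import Literature.MeasureTheory.Integral.SubmersionPushforwardDensity
import Literature.MeasureTheory.Integral.PushforwardDensityGluing
import Mathlib.Analysis.Calculus.FDeriv.Analytic
import Mathlib.Analysis.Normed.Operator.BoundedLinearMaps

/-!
# ANALYTIC SUBMERSION + FINITELY MANY TRANSVERSE ANALYTIC THRESHOLDS ⇒ the push-forward of a density that is continuous OFF THE UNION of
# the threshold hypersurfaces still has a CONTINUOUS density (locally) — the «corner» form of «(F1) + the fibre species of (F2)»

Generic calculus ∕ measure theory on finite-dimensional real spaces; every declaration is a THEOREM proved here (no `def`, no named fact, no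
`sorry`).  LOCATED CONSUMER (cell `pub-ymgap`, YM-PLAN Track A, node N09 [B12] width seat `pub-ymgap-dag-n09-w2` g4, `--supports` K1⁸
`StabilityBRunRowsAtRecordR13SepCoPH` = stmt-QuantumFields-26907, count-neutral helper; lineage of the K1⁷ 20542 helpers).  The sibling file
`AnalyticSubmersionSharpDensity` (this lineage, g3, p613264) treats ONE analytic threshold `g` transverse to the fibre at `a`.  A small-field
characteristic function of [Balaban1987RG1] (2.9) is a PRODUCT of many bond-wise sharp indicators, so at a «corner» configuration SEVERAL thresholds
are active at once; the product `Π g_i` is analytic but NOT transverse there (its differential vanishes where two factors do), so p613264 does not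
apply.  THIS FILE proves the corner form directly: finitely many thresholds `g_i`, each analytic at `a` and each transverse to the fibre
(`Dg_i(a)` does not vanish on `ker DM(a)`), densities continuous at the points where ALL `g_i ≠ 0`.  The proof is p613264's verbatim with the
threshold set replaced by the finite UNION `⋃_i {g_i = 0}`: each trace on a nearby fibre ball is null by [Mityagin2015]
(`FibreCoordinates.measure_fibre_inter_zeroSet_eq_zero`), hence so is the union, and `FibreCoordinates.continuousOn_density_of_fibreCoordinates_of_ae`
+ the Haar transport of `SubmersionPushforwardDensity` conclude.

WHAT IS PROVED (namespace `Literature.MeasureTheory.Integral.AnalyticSubmersion`).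
* ★★★ **`exists_continuousOn_density_map_of_analytic_submersion_sharp_finite`** — `E`, `Y` finite-dimensional real normed Borel spaces with
  additive Haar measures `μE`, `μY`; `M : E → Y` measurable, `AnalyticAt ℝ M a`, `(fderiv ℝ M a).range = ⊤`; `ι` finite, `g : ι → E → ℝ` with
  `AnalyticAt ℝ (g i) a` and `∃ v ∈ ker (fderiv ℝ M a), fderiv ℝ (g i) a v ≠ 0` for every `i`.  Then ∃ open `O ∋ a`, `D ∋ M a` such that for every
  `r : E → ℝ` measurable, `0 ≤ r`, bounded on `O`, zero off `O`, and CONTINUOUS AT every `x ∈ O` with `∀ i, g i x ≠ 0`: ∃ `I : Y → ℝ`, `0 ≤ I`,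
  `ContinuousOn I D`, and `(r·μE)(M⁻¹A) = ∫_A I dμY` for every Borel `A ⊆ D`.
* ★★ `exists_continuous_density_map_of_submersion_sharp_finite_of_isCompact` — the GLOBAL corner form (compact support `K`; at a point
  with no active threshold the `C¹` engine, at a corner the finite-family engine for the active sub-family; glued by
  `PushforwardDensityGluing.exists_continuous_density_of_locally'`).

HONEST SCOPE.  (i) Local, near one point; `r` must vanish off the chart neighbourhood `O`.  (ii) Each threshold must be transverse to the fibre
at `a` (fibres contained in some `{g_i = 0}` are genuinely excluded).  (iii) Nothing model-specific: the analytic-submersion property of the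
chart-read (0.4) averaging, the analyticity and transversality of the (2.9) threshold functionals are the consumer's inputs; no claim about
Bałaban's renormalization group, N09, or the Clay problem is made here.
-/

noncomputable section

namespace Literature.MeasureTheory.Integral.AnalyticSubmersion

open _root_.MeasureTheory _root_.MeasureTheory.Measure Set Function Filter Metric
open scoped ENNReal NNReal Topology

variable {E Y : Type*}
  [NormedAddCommGroup E] [NormedSpace ℝ E] [FiniteDimensional ℝ E] [MeasurableSpace E] [BorelSpace E]
  [NormedAddCommGroup Y] [NormedSpace ℝ Y] [FiniteDimensional ℝ Y] [MeasurableSpace Y] [BorelSpace Y]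

/-- A real function on a real normed space with a NON-ZERO derivative at a point of an open set does not vanish identically on that
set (private copy of the sibling file's helper). [folklore] -/
private theorem exists_ne_zero_of_fderiv_ne_zero' {K : Type*} [NormedAddCommGroup K] [NormedSpace ℝ K] {h : K → ℝ} {V : Set K}
    (hV : IsOpen V) {B : K} (hB : B ∈ V) (hd : fderiv ℝ h B ≠ 0) : ∃ B₀ ∈ V, h B₀ ≠ 0 := by
  by_contra hcon
  simp only [not_exists, not_and, not_not] at hcon
  apply hd
  have heq : h =ᶠ[𝓝 B] fun _ => (0 : ℝ) :=
    Filter.eventuallyEq_of_mem (hV.mem_nhds hB) fun x hx => hcon x hx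
  rw [heq.fderiv_eq]
  exact fderiv_const_apply 0

/-- ★★★ **ANALYTIC SUBMERSION + FINITELY MANY TRANSVERSE ANALYTIC THRESHOLDS ⇒ CONTINUOUS PUSH-FORWARD DENSITY FOR DENSITIES CONTINUOUS OFF
THE UNION OF THE THRESHOLD SETS (corner form).**  See the module docstring.  (p613264's proof with the threshold set replaced by the finite
union `⋃_i {g_i = 0}`: implicit-function fibre coordinates, analytic by `OpenPartialHomeomorph.analyticAt_symm`; transversality of each `g_i` ⇒
non-vanishing fibre derivatives ⇒ [Mityagin2015] null fibre traces, null union; `FibreCoordinates.continuousOn_density_of_fibreCoordinates_of_ae`;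
Haar transport `SubmersionPushforward.exists_haarFactor_lintegral_comp_equiv`.)
[cite: EvansGariepy1992, §3.4.2 Thm 1 and §3.4.3 Thm 2 (C¹-submersion special case)] [cite: Mityagin2015, Proposition 1]
[cite: Balaban1987RG1, (2.9)–(2.10) pp.266–267 (measure-level reading)] -/
theorem exists_continuousOn_density_map_of_analytic_submersion_sharp_finite {ι : Type*} [Finite ι] (μE : Measure E)
    [μE.IsAddHaarMeasure] (μY : Measure Y) [μY.IsAddHaarMeasure] {M : E → Y} (hMm : Measurable M) {a : E}
    (hMan : AnalyticAt ℝ M a) (hsurj : (fderiv ℝ M a).range = ⊤) {g : ι → E → ℝ} (hgan : ∀ i, AnalyticAt ℝ (g i) a)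
    (htr : ∀ i, ∃ v ∈ (fderiv ℝ M a).ker, fderiv ℝ (g i) a v ≠ 0) :
    ∃ O : Set E, IsOpen O ∧ a ∈ O ∧ ∃ D : Set Y, IsOpen D ∧ M a ∈ D ∧
      ∀ r : E → ℝ, Measurable r → (∀ x, 0 ≤ r x) → (∀ x ∈ O, (∀ i, g i x ≠ 0) → ContinuousAt r x) →
        (∃ C, ∀ x ∈ O, r x ≤ C) →
        (∀ x, x ∉ O → r x = 0) →
        ∃ I : Y → ℝ, ContinuousOn I D ∧ (∀ W, 0 ≤ I W) ∧
          ∀ A : Set Y, MeasurableSet A → A ⊆ D →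
            (μE.withDensity fun x => ENNReal.ofReal (r x)) (M ⁻¹' A) = ∫⁻ W in A, ENNReal.ofReal (I W) ∂μY := by
  classical
  haveI : CompleteSpace E := FiniteDimensional.complete ℝ E
  haveI : CompleteSpace Y := FiniteDimensional.complete ℝ Y
  have hM : ContDiffAt ℝ 1 M a := hMan.contDiffAt.of_le le_top
  -- the differential and the implicit-function chart `φ = (M, π(· − a))`
  set f' : E →L[ℝ] Y := fderiv ℝ M a with hf'def
  have hf : HasStrictFDerivAt M f' a := hM.hasStrictFDerivAt one_ne_zero
  have hker : f'.ker.ClosedComplemented := f'.ker_closedComplemented_of_finiteDimensional_range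
  haveI : CompleteSpace f'.ker := FiniteDimensional.complete ℝ f'.ker
  letI : MeasurableSpace f'.ker := borel f'.ker
  haveI : BorelSpace f'.ker := ⟨rfl⟩
  set π : E →L[ℝ] f'.ker := Classical.choose hker with hπ
  have hπid : ∀ v : f'.ker, π v = v := Classical.choose_spec hker
  set 𝒟 : ImplicitFunctionData ℝ E Y f'.ker := HasStrictFDerivAt.implicitFunctionDataOfComplemented M f' hf hsurj hker
    with h𝒟
  set φ := 𝒟.toOpenPartialHomeomorph with hφ
  have hφ1 : ∀ x, (φ x).1 = M x := fun x => rfl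
  have hφapp : ∀ x, φ x = (M x, π (x - a)) := fun x => rfl
  have ha : a ∈ φ.source := 𝒟.pt_mem_toOpenPartialHomeomorph_source
  have hφa : φ a = (M a, 0) := by rw [hφapp]; simp
  -- the derivative of `φ` at `a` is the equivalence `e₀ = (f', π)`
  set e₀ : E ≃L[ℝ] Y × f'.ker := f'.equivProdOfSurjectiveOfIsCompl π hsurj
    (LinearMap.range_eq_of_proj (Classical.choose_spec hker)) (LinearMap.isCompl_of_proj (Classical.choose_spec hker)) with he₀
  have hφder : HasStrictFDerivAt φ (e₀ : E →L[ℝ] Y × f'.ker) a := 𝒟.hasStrictFDerivAt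
  have he₀v : ∀ v : f'.ker, e₀ (v : E) = (0, v) := by
    intro v
    rw [he₀, ContinuousLinearMap.equivProdOfSurjectiveOfIsCompl_apply, hπid v]
    have : f' (v : E) = 0 := v.2
    rw [this]
  -- `φ` is analytic near `a` with invertible derivative; `g` analytic near `a`
  have hπan : ∀ x, AnalyticAt ℝ (fun x => π (x - a)) x := fun x =>
    (π.analyticAt _).comp (analyticAt_id.sub analyticAt_const)
  have hφanA : ∀ᶠ x in 𝓝 a, AnalyticAt ℝ φ x := by
    filter_upwards [hMan.eventually_analyticAt] with x hx
    exact hx.prod (hπan x)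
  have hφC1 : ContDiffAt ℝ 1 φ a := (hMan.prod (hπan a)).contDiffAt.of_le le_top
  have hinvA : ∀ᶠ x in 𝓝 a, (fderiv ℝ φ x).IsInvertible := by
    have hcont : ContinuousAt (fderiv ℝ φ) a := hφC1.continuousAt_fderiv one_ne_zero
    have hmem : fderiv ℝ φ a ∈ Set.range ((↑) : (E ≃L[ℝ] Y × f'.ker) → E →L[ℝ] Y × f'.ker) :=
      ⟨e₀, hφder.hasFDerivAt.fderiv.symm⟩
    filter_upwards [hcont.preimage_mem_nhds (ContinuousLinearEquiv.isOpen.mem_nhds hmem)] with x hx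
    obtain ⟨e, he⟩ := hx
    exact ⟨e, he⟩
  have hganA : ∀ᶠ x in 𝓝 a, ∀ i, AnalyticAt ℝ (g i) x := eventually_all.2 fun i => (hgan i).eventually_analyticAt
  obtain ⟨Nₐ, hNₐsub, hNₐo, haNₐ⟩ : ∃ Nₐ : Set E, Nₐ ⊆ {x | AnalyticAt ℝ φ x ∧ (fderiv ℝ φ x).IsInvertible ∧ ∀ i, AnalyticAt ℝ (g i) x} ∧
      IsOpen Nₐ ∧ a ∈ Nₐ := by
    obtain ⟨N, hN, hNo, hmem⟩ := _root_.eventually_nhds_iff.1 ((hφanA.and hinvA).and hganA)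
    exact ⟨N, fun x hx => ⟨(hN x hx).1.1, (hN x hx).1.2, (hN x hx).2⟩, hNo, hmem⟩
  -- the window `W'` in the target: `φ.symm` analytic (hence C¹) there, `g` analytic at `φ.symm p`
  set W' : Set (Y × f'.ker) := φ.target ∩ φ.symm ⁻¹' Nₐ with hW'
  have hW'o : IsOpen W' := by
    have h := φ.symm.isOpen_inter_preimage hNₐo
    rwa [φ.symm_source] at h
  have haW' : φ a ∈ W' := ⟨φ.map_source ha, by show φ.symm (φ a) ∈ Nₐ; rw [φ.left_inv ha]; exact haNₐ⟩
  have hW't : W' ⊆ φ.target := fun p hp => hp.1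
  have hsymN : ∀ p ∈ W', φ.symm p ∈ Nₐ := fun p hp => hp.2
  have hanOn : ∀ p ∈ W', AnalyticAt ℝ φ.symm p := by
    intro p hp
    obtain ⟨e, he⟩ := (hNₐsub (hsymN p hp)).2.1
    exact φ.analyticAt_symm (hW't hp) (hNₐsub (hsymN p hp)).1 he.symm
  have hganOn : ∀ p ∈ W', ∀ i, AnalyticAt ℝ (g i) (φ.symm p) := fun p hp => (hNₐsub (hsymN p hp)).2.2
  have hsmOn : ContDiffOn ℝ 1 φ.symm W' := fun p hp => ((hanOn p hp).contDiffAt.of_le le_top).contDiffWithinAt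
  have hdiff : ∀ p ∈ W', HasFDerivAt φ.symm (fderiv ℝ φ.symm p) p := fun p hp =>
    ((hanOn p hp).differentiableAt).hasFDerivAt
  have hcontD : ContinuousOn (fderiv ℝ φ.symm) W' := hsmOn.continuousOn_fderiv_of_isOpen hW'o le_rfl
  -- the composites `g i ∘ φ.symm` are C¹ on `W'`; their fibre derivatives along `v i` are non-zero near `φ a`
  choose v hvker hv using htr
  set gφ : ι → Y × f'.ker → ℝ := fun i q => g i (φ.symm q) with hgφ
  have hgφan : ∀ i, ∀ p ∈ W', AnalyticAt ℝ (gφ i) p := fun i p hp => (hganOn p hp i).comp (hanOn p hp)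
  have hgφC1 : ∀ i, ContDiffOn ℝ 1 (gφ i) W' := fun i p hp => ((hgφan i p hp).contDiffAt.of_le le_top).contDiffWithinAt
  have hTcont : ∀ i, ContinuousOn (fun p => fderiv ℝ (gφ i) p ((0 : Y), (⟨v i, hvker i⟩ : f'.ker))) W' := fun i =>
    (ContinuousLinearMap.apply ℝ ℝ ((0 : Y), (⟨v i, hvker i⟩ : f'.ker))).continuous.comp_continuousOn
      ((hgφC1 i).continuousOn_fderiv_of_isOpen hW'o le_rfl)
  have hTa : ∀ i, fderiv ℝ (gφ i) (φ a) ((0 : Y), (⟨v i, hvker i⟩ : f'.ker)) = fderiv ℝ (g i) a (v i) := by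
    intro i
    have hsd : HasFDerivAt φ.symm ((e₀.symm : Y × f'.ker →L[ℝ] E)) (φ a) :=
      φ.hasFDerivAt_symm (φ.map_source ha) (by rw [φ.left_inv ha]; exact hφder.hasFDerivAt)
    have hga : HasFDerivAt (g i) (fderiv ℝ (g i) a) (φ.symm (φ a)) := by
      rw [φ.left_inv ha]; exact (hgan i).differentiableAt.hasFDerivAt
    have hcomp : HasFDerivAt (gφ i) ((fderiv ℝ (g i) a).comp (e₀.symm : Y × f'.ker →L[ℝ] E)) (φ a) := hga.comp (φ a) hsd
    rw [hcomp.fderiv, ContinuousLinearMap.comp_apply]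
    congr 1
    show e₀.symm ((0 : Y), (⟨v i, hvker i⟩ : f'.ker)) = v i
    rw [ContinuousLinearEquiv.symm_apply_eq, he₀v ⟨v i, hvker i⟩]
  have hTne : ∀ᶠ p in 𝓝 (φ a), ∀ i, fderiv ℝ (gφ i) p ((0 : Y), (⟨v i, hvker i⟩ : f'.ker)) ≠ 0 :=
    eventually_all.2 fun i =>
      (((hTcont i).continuousAt (hW'o.mem_nhds haW')).eventually_ne (by rw [hTa i]; exact hv i))
  -- the final target window `W ⊆ W'` on which all the fibre derivatives are non-zero
  obtain ⟨W, hWsub, hWo, haW⟩ : ∃ W : Set (Y × f'.ker),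
      W ⊆ W' ∩ {p | ∀ i, fderiv ℝ (gφ i) p ((0 : Y), (⟨v i, hvker i⟩ : f'.ker)) ≠ 0} ∧ IsOpen W ∧ φ a ∈ W := by
    obtain ⟨W, hW, hWo, hmem⟩ := _root_.eventually_nhds_iff.1 ((eventually_mem_set.2 (hW'o.mem_nhds haW')).and hTne)
    exact ⟨W, fun p hp => hW p hp, hWo, hmem⟩
  have hWW' : W ⊆ W' := fun p hp => (hWsub hp).1
  -- a linear identification `L : E ≃L Y × ker f'`
  have hrank : Module.finrank ℝ E = Module.finrank ℝ (Y × f'.ker) := by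
    have h1 := LinearMap.finrank_range_add_finrank_ker (f' : E →ₗ[ℝ] Y)
    have h2 : Module.finrank ℝ (LinearMap.range (f' : E →ₗ[ℝ] Y)) = Module.finrank ℝ Y := by
      rw [show LinearMap.range (f' : E →ₗ[ℝ] Y) = ⊤ from hsurj, finrank_top]
    rw [Module.finrank_prod, ← h1, h2]
  set L : E ≃L[ℝ] Y × f'.ker := ContinuousLinearEquiv.ofFinrankEq hrank with hL
  -- radii: a compact ball inside `W`, and the product window of half the radius
  obtain ⟨ε, hε, hεW⟩ : ∃ ε > 0, closedBall (φ a) ε ⊆ W := nhds_basis_closedBall.mem_iff.1 (hWo.mem_nhds haW)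
  set D : Set Y := ball (M a) (ε / 2) with hD
  set V : Set f'.ker := ball 0 (ε / 2) with hV
  set U : Set (Y × f'.ker) := D ×ˢ V with hU
  have hε2 : 0 < ε / 2 := by positivity
  have hUball : U = ball (φ a) (ε / 2) := by rw [hU, hD, hV, hφa, ball_prod_same]
  have hUW : U ⊆ W := by
    rw [hUball]; exact (ball_subset_closedBall.trans (closedBall_subset_closedBall (by linarith))).trans hεW
  have hUW' : U ⊆ W' := hUW.trans hWW'
  have hUt : U ⊆ φ.target := hUW'.trans hW't
  have hUo : IsOpen U := by rw [hUball]; exact isOpen_ball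
  have hUm : MeasurableSet U := hUo.measurableSet
  have haU : φ a ∈ U := by rw [hUball]; exact mem_ball_self hε2
  have hVo : IsOpen V := isOpen_ball
  have hVc : IsConnected V := (convex_ball (0 : f'.ker) (ε / 2)).isConnected ⟨0, mem_ball_self hε2⟩
  -- bound for the Jacobian of `L ∘ φ.symm` on the compact ball
  have hJcont : ContinuousOn (fun p => ((L : E →L[ℝ] Y × f'.ker).comp (fderiv ℝ φ.symm p)).det) W' :=
    ContinuousLinearMap.continuous_det.comp_continuousOn
      (((ContinuousLinearMap.compL ℝ (Y × f'.ker) E (Y × f'.ker)) (L : E →L[ℝ] Y × f'.ker)).continuous.comp_continuousOn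
        hcontD)
  obtain ⟨CJ, hCJ⟩ : ∃ CJ, ∀ p ∈ closedBall (φ a) ε,
      ‖((L : E →L[ℝ] Y × f'.ker).comp (fderiv ℝ φ.symm p)).det‖ ≤ CJ :=
    (isCompact_closedBall (φ a) ε).exists_bound_of_continuousOn (hJcont.mono (hεW.trans hWW'))
  -- the chart neighbourhood `O = φ.symm (U)`
  set O : Set E := φ.symm '' U with hO
  have hOo : IsOpen O := φ.isOpen_image_symm_of_subset_target hUo hUt
  have haO : a ∈ O := ⟨φ a, haU, φ.left_inv ha⟩
  refine ⟨O, hOo, haO, D, isOpen_ball, mem_ball_self hε2, ?_⟩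
  intro r hrm hr0 hrc hrb hrO
  obtain ⟨Cr, hCr⟩ := hrb
  -- the model objects on `Y × ker f'`
  set Ψ : Y × f'.ker → Y × f'.ker := U.piecewise (fun p => L (φ.symm p)) (fun _ => L a) with hΨ
  set Ψ' : Y × f'.ker → (Y × f'.ker →L[ℝ] Y × f'.ker) :=
    fun p => (L : E →L[ℝ] Y × f'.ker).comp (fderiv ℝ φ.symm p) with hΨ'
  set M' : Y × f'.ker → Y := fun y => M (L.symm y) with hM'
  set r' : Y × f'.ker → ℝ := fun y => r (L.symm y) with hr'
  set g' : ι → Y × f'.ker → ℝ := fun i y => g i (L.symm y) with hg'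
  have hΨU : ∀ p ∈ U, Ψ p = L (φ.symm p) := fun p hp => by rw [hΨ, piecewise_eq_of_mem _ _ _ hp]
  have hr'Ψ : ∀ p ∈ U, r' (Ψ p) = r (φ.symm p) := fun p hp => by
    show r (L.symm (Ψ p)) = r (φ.symm p); rw [hΨU p hp, L.symm_apply_apply]
  have hg'Ψ : ∀ i, ∀ p ∈ U, g' i (Ψ p) = gφ i p := fun i p hp => by
    show g i (L.symm (Ψ p)) = g i (φ.symm p); rw [hΨU p hp, L.symm_apply_apply]
  -- hypotheses of the M4 engine (as in `SubmersionPushforwardDensity`)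
  have hΨ'w : ∀ p ∈ U, HasFDerivWithinAt Ψ (Ψ' p) U p := by
    intro p hp
    have h : HasFDerivAt (fun q => L (φ.symm q)) (Ψ' p) p :=
      (L : E →L[ℝ] Y × f'.ker).hasFDerivAt.comp p (hdiff p (hUW' hp))
    exact h.hasFDerivWithinAt.congr (fun q hq => hΨU q hq) (hΨU p hp)
  have hinj : InjOn Ψ U := by
    intro p hp q hq hpq
    rw [hΨU p hp, hΨU q hq] at hpq
    exact φ.symm.injOn (φ.symm_source.symm ▸ hUt hp) (φ.symm_source.symm ▸ hUt hq) (L.injective hpq)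
  have hΨm : Measurable Ψ := by
    refine ContinuousOn.measurable_piecewise ?_ continuousOn_const hUm
    exact L.continuous.comp_continuousOn (φ.continuousOn_symm.mono hUt)
  have hJm : Measurable fun p => (Ψ' p).det :=
    ContinuousLinearMap.continuous_det.measurable.comp
      (((ContinuousLinearMap.compL ℝ (Y × f'.ker) E (Y × f'.ker)) (L : E →L[ℝ] Y × f'.ker)).continuous.measurable.comp
        (measurable_fderiv ℝ φ.symm))
  have hM'm : Measurable M' := hMm.comp L.symm.continuous.measurable
  have hM'Ψ : ∀ p ∈ U, M' (Ψ p) = p.1 := by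
    intro p hp
    rw [hΨU p hp, hM']
    show M (L.symm (L (φ.symm p))) = p.1
    rw [L.symm_apply_apply, ← hφ1, φ.right_inv (hUt hp)]
  have hr'm : Measurable r' := hrm.comp L.symm.continuous.measurable
  have hr'0 : ∀ y, 0 ≤ r' y := fun y => hr0 _
  have hsupp : ∀ y, M' y ∈ D → y ∉ Ψ '' U → r' y = 0 := by
    intro y _ hy
    apply hrO
    rintro ⟨p, hp, hpy⟩
    exact hy ⟨p, hp, by rw [hΨU p hp, hpy, L.apply_symm_apply]⟩
  have hnn : ∀ p, 0 ≤ |(Ψ' p).det| * r' (Ψ p) := fun p => mul_nonneg (abs_nonneg _) (hr'0 _)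
  have hCI : ∀ p ∈ D ×ˢ V, |(Ψ' p).det| * r' (Ψ p) ≤ max CJ 0 * max Cr 0 := by
    intro p hp
    rw [← hU] at hp
    have h1 : |(Ψ' p).det| ≤ max CJ 0 :=
      (le_trans (by simpa [Real.norm_eq_abs] using hCJ p ((ball_subset_closedBall.trans
        (closedBall_subset_closedBall (by linarith))) (hUball ▸ hp))) (le_max_left _ _))
    have h2 : r' (Ψ p) ≤ max Cr 0 := by
      rw [hr'Ψ p hp]
      exact (hCr _ ⟨p, hp, rfl⟩).trans (le_max_left _ _)
    exact mul_le_mul h1 h2 (hr'0 _) (le_max_of_le_right le_rfl)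
  have hVm : MeasurableSet V := isOpen_ball.measurableSet
  have hDm : MeasurableSet D := isOpen_ball.measurableSet
  have hVfin : (Measure.addHaar : Measure f'.ker) V ≠ ∞ := (measure_ball_lt_top).ne
  -- ★ the FIBRE (F2): for each `W₀ ∈ D` and each `i` the threshold set `{g' i ∘ Ψ = 0}` has null trace on the fibre window over `W₀`;
  -- hence so has their finite union
  have hfib1 : ∀ W₀ ∈ D, ∀ i, (Measure.addHaar : Measure f'.ker)
      {B | B ∈ V ∧ (W₀, B) ∈ {p : Y × f'.ker | g' i (Ψ p) = 0}} = 0 := by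
    intro W₀ hW₀ i
    have hmemU : ∀ B ∈ V, (W₀, B) ∈ U := fun B hB => by rw [hU]; exact ⟨hW₀, hB⟩
    -- analyticity of the fibre section of `g' i ∘ Ψ` on `V`
    have han : AnalyticOnNhd ℝ (fun B => g' i (Ψ (W₀, B))) V := by
      intro B hB
      have h1 : AnalyticAt ℝ (fun B : f'.ker => gφ i (W₀, B)) B :=
        (hgφan i _ (hUW' (hmemU B hB))).comp (analyticAt_const.prod analyticAt_id)
      refine h1.congr ?_
      filter_upwards [(hUo.preimage (Continuous.prodMk_right W₀)).mem_nhds (hmemU B hB)] with B' hB'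
      exact (hg'Ψ i _ hB').symm
    -- non-vanishing at some point of `V`: the fibre derivative at `B = 0` is non-zero
    have h0V : (0 : f'.ker) ∈ V := mem_ball_self hε2
    have hne : ∃ B₀ ∈ V, g' i (Ψ (W₀, B₀)) ≠ 0 := by
      have hW₀U : (W₀, (0 : f'.ker)) ∈ U := hmemU 0 h0V
      have hT : fderiv ℝ (gφ i) (W₀, 0) ((0 : Y), (⟨v i, hvker i⟩ : f'.ker)) ≠ 0 := (hWsub (hUW hW₀U)).2 i
      have hsec : HasFDerivAt (fun B : f'.ker => gφ i (W₀, B))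
          ((fderiv ℝ (gφ i) (W₀, 0)).comp (ContinuousLinearMap.inr ℝ Y f'.ker)) 0 := by
        have hg1 : HasFDerivAt (gφ i) (fderiv ℝ (gφ i) (W₀, 0)) (W₀, 0) :=
          ((hgφan i _ (hUW' hW₀U)).differentiableAt).hasFDerivAt
        exact hg1.comp (0 : f'.ker) (hasFDerivAt_prodMk_right W₀ 0)
      have hdne : fderiv ℝ (fun B : f'.ker => gφ i (W₀, B)) 0 ≠ 0 := by
        rw [hsec.fderiv]
        intro hzero
        apply hT
        have := congrArg (fun T : f'.ker →L[ℝ] ℝ => T (⟨v i, hvker i⟩ : f'.ker)) hzero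
        simpa [ContinuousLinearMap.comp_apply, ContinuousLinearMap.inr_apply] using this
      obtain ⟨B₀, hB₀, hB₀ne⟩ := exists_ne_zero_of_fderiv_ne_zero' hVo h0V hdne
      exact ⟨B₀, hB₀, by rw [hg'Ψ i _ (hmemU B₀ hB₀)]; exact hB₀ne⟩
    exact FibreCoordinates.measure_fibre_inter_zeroSet_eq_zero (Measure.addHaar : Measure f'.ker) hVo hVc han hne
  have hfib : ∀ W₀ ∈ D, (Measure.addHaar : Measure f'.ker)
      {B | B ∈ V ∧ (W₀, B) ∈ {p : Y × f'.ker | ∃ i, g' i (Ψ p) = 0}} = 0 := by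
    intro W₀ hW₀
    haveI : Fintype ι := Fintype.ofFinite ι
    have hsub : {B | B ∈ V ∧ (W₀, B) ∈ {p : Y × f'.ker | ∃ i, g' i (Ψ p) = 0}} ⊆
        ⋃ i, {B | B ∈ V ∧ (W₀, B) ∈ {p : Y × f'.ker | g' i (Ψ p) = 0}} := by
      rintro B ⟨hBV, i, hi⟩
      exact mem_iUnion.2 ⟨i, hBV, hi⟩
    exact measure_mono_null hsub ((measure_iUnion_null_iff).2 fun i => hfib1 W₀ hW₀ i)
  -- ★ fibrewise-a.e. continuity of the fibre integrand in the coarse variable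
  have hcont : ∀ W₀ ∈ D, ∀ᵐ B ∂((Measure.addHaar : Measure f'.ker).restrict V),
      ContinuousWithinAt (fun W => |(Ψ' (W, B)).det| * r' (Ψ (W, B))) D W₀ := by
    intro W₀ hW₀
    refine FibreCoordinates.ae_continuousWithinAt_of_null_fibreSet (Measure.addHaar : Measure f'.ker) hVm
      (G := fun p => |(Ψ' p).det| * r' (Ψ p)) (D := D)
      (Z := {p : Y × f'.ker | ∃ i, g' i (Ψ p) = 0}) (hfib W₀ hW₀) (fun B hB hBZ => ?_)
    have hmemU : ∀ W ∈ D, (W, B) ∈ U := fun W hW => by rw [hU]; exact ⟨hW, hB⟩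
    have hpU : (W₀, B) ∈ U := hmemU W₀ hW₀
    -- the Jacobian factor is continuous in `W`
    have hJ : ContinuousWithinAt (fun W => |(Ψ' (W, B)).det|) D W₀ :=
      ((continuous_abs.comp_continuousOn (hJcont.mono hUW')).comp (Continuous.prodMk_left B).continuousOn
        (fun W hW => hmemU W hW)).continuousWithinAt hW₀
    -- the density factor: `r` continuous at `φ.symm (W₀, B)` (off the threshold set), `φ.symm` continuous
    have hx₀ : ∀ i, g i (φ.symm (W₀, B)) ≠ 0 := by
      intro i h0; apply hBZ; refine ⟨i, ?_⟩; show g' i (Ψ (W₀, B)) = 0; rw [hg'Ψ i _ hpU]; exact h0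
    have hrcont : ContinuousAt r (φ.symm (W₀, B)) := hrc _ ⟨(W₀, B), hpU, rfl⟩ hx₀
    have hsymc : ContinuousWithinAt (fun W => φ.symm (W, B)) D W₀ :=
      ((φ.continuousOn_symm.mono hUt).comp (Continuous.prodMk_left B).continuousOn (fun W hW => hmemU W hW))
        |>.continuousWithinAt hW₀
    have hR : ContinuousWithinAt (fun W => r (φ.symm (W, B))) D W₀ :=
      ContinuousAt.comp_continuousWithinAt (f := fun W => φ.symm (W, B)) (x := W₀) hrcont hsymc
    refine (hJ.mul hR).congr (fun W hW => ?_) ?_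
    · show |(Ψ' (W, B)).det| * r' (Ψ (W, B)) = |(Ψ' (W, B)).det| * r (φ.symm (W, B))
      rw [hr'Ψ _ (hmemU W hW)]
    · show |(Ψ' (W₀, B)).det| * r' (Ψ (W₀, B)) = |(Ψ' (W₀, B)).det| * r (φ.symm (W₀, B))
      rw [hr'Ψ _ hpU]
  -- the M4 engine, sharp form, in the model `Y × ker f'`
  obtain ⟨hIcont, hIdens⟩ := FibreCoordinates.continuousOn_density_of_fibreCoordinates_of_ae μY
    (Measure.addHaar : Measure f'.ker) hDm hVm hVfin hU hΨ'w hinj hΨm hJm hM'm hM'Ψ hr'm hr'0 hsupp hcont hCI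
  -- transport back to `E` along `L`
  obtain ⟨c, hc, hcid⟩ := SubmersionPushforward.exists_haarFactor_lintegral_comp_equiv μE μY
    (Measure.addHaar : Measure f'.ker) L
  set I₀ : Y → ℝ := fun W => ∫ B in V, |(Ψ' (W, B)).det| * r' (Ψ (W, B)) ∂(Measure.addHaar : Measure f'.ker) with hI₀
  have hI₀0 : ∀ W, 0 ≤ I₀ W := fun W =>
    setIntegral_nonneg hVm fun B _ => mul_nonneg (abs_nonneg _) (hr'0 _)
  refine ⟨fun W => (c : ℝ) * I₀ W, (continuousOn_const.mul hIcont), fun W => mul_nonneg c.coe_nonneg (hI₀0 W), ?_⟩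
  intro A hA hAD
  have hpre : M ⁻¹' A = L ⁻¹' (M' ⁻¹' A) := by
    ext x
    simp only [mem_preimage, hM', L.symm_apply_apply]
  calc (μE.withDensity fun x => ENNReal.ofReal (r x)) (M ⁻¹' A)
      = ∫⁻ x, (M ⁻¹' A).indicator (fun x => ENNReal.ofReal (r x)) x ∂μE := by
        rw [withDensity_apply _ (hMm hA), lintegral_indicator (hMm hA)]
    _ = ∫⁻ x, (M' ⁻¹' A).indicator (fun y => ENNReal.ofReal (r' y)) (L x) ∂μE := by
        refine lintegral_congr (fun x => ?_)
        rw [hpre]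
        simp only [indicator, mem_preimage, hr', L.symm_apply_apply]
    _ = c * ∫⁻ y, (M' ⁻¹' A).indicator (fun y => ENNReal.ofReal (r' y)) y ∂(μY.prod Measure.addHaar) :=
        hcid _ (((ENNReal.measurable_ofReal.comp hr'm)).indicator (hM'm hA))
    _ = c * ((μY.prod (Measure.addHaar : Measure f'.ker)).withDensity fun y => ENNReal.ofReal (r' y)) (M' ⁻¹' A) := by
        rw [withDensity_apply _ (hM'm hA), lintegral_indicator (hM'm hA)]
    _ = c * ∫⁻ W in A, ENNReal.ofReal (I₀ W) ∂μY := by rw [hIdens A hA hAD]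
    _ = ∫⁻ W in A, ENNReal.ofReal ((c : ℝ) * I₀ W) ∂μY := by
        rw [← lintegral_const_mul' _ _ ENNReal.coe_ne_top]
        refine lintegral_congr (fun W => ?_)
        rw [ENNReal.ofReal_mul c.coe_nonneg, ENNReal.ofReal_coe_nnreal]

/-- ★★ **CORNER THRESHOLDS, GLOBALLY.**  `M : E → Y` measurable, `C¹` with surjective differential at every point of a compact `K`; a FINITE
family of threshold functions `g i : E → ℝ`, each continuous at the points of `K`; at every `a ∈ K` at which some thresholds vanish, `M` is
real-analytic at `a` and every vanishing `g i` is real-analytic at `a` and TRANSVERSE to the fibre (`∃ v ∈ ker DM(a), Dg_i(a) v ≠ 0`).  Then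
every measurable bounded `r ≥ 0` vanishing off `K` and continuous at each `x ∈ K` with `∀ i, g i x ≠ 0` (a product of sharp indicators times a
continuous factor) has a push-forward density `I ≥ 0` CONTINUOUS ON ALL OF `Y`: `(r·μE)(M⁻¹A) = ∫⁻_A I dμY` for every measurable `A`.
(Sharp-form gluing `PushforwardDensityGluing.exists_continuous_density_of_locally'`: at a point with no active threshold the `C¹` engine with
its window cut to `⋂_i int{g_i ≠ 0}`; at a corner the finite-family engine for the ACTIVE sub-family, window cut by the inactive ones.)
[cite: EvansGariepy1992, §3.4.3 Thm 2 (C¹-submersion special case)] [cite: Mityagin2015, Proposition 1] -/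
theorem exists_continuous_density_map_of_submersion_sharp_finite_of_isCompact {ι : Type*} [Finite ι] (μE : Measure E)
    [μE.IsAddHaarMeasure] (μY : Measure Y) [μY.IsAddHaarMeasure] {M : E → Y} (hMm : Measurable M) {K : Set E} (hK : IsCompact K)
    (hM : ∀ a ∈ K, ContDiffAt ℝ 1 M a) (hsurj : ∀ a ∈ K, (fderiv ℝ M a).range = ⊤)
    {g : ι → E → ℝ} (hgc : ∀ a ∈ K, ∀ i, ContinuousAt (g i) a)
    (hMan : ∀ a ∈ K, (∃ i, g i a = 0) → AnalyticAt ℝ M a)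
    (hzero : ∀ a ∈ K, ∀ i, g i a = 0 → AnalyticAt ℝ (g i) a ∧ ∃ v ∈ (fderiv ℝ M a).ker, fderiv ℝ (g i) a v ≠ 0)
    (r : E → ℝ) (hrm : Measurable r) (hr0 : ∀ x, 0 ≤ r x) (hrc : ∀ x ∈ K, (∀ i, g i x ≠ 0) → ContinuousAt r x)
    (hrC : ∃ C : ℝ, ∀ x, r x ≤ C) (hrK : ∀ x, x ∉ K → r x = 0) :
    ∃ I : Y → ℝ, Continuous I ∧ (∀ W, 0 ≤ I W) ∧ ∀ A : Set Y, MeasurableSet A →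
      (μE.withDensity fun x => ENNReal.ofReal (r x)) (M ⁻¹' A) = ∫⁻ W in A, ENNReal.ofReal (I W) ∂μY := by
  classical
  haveI : Fintype ι := Fintype.ofFinite ι
  refine PushforwardDensityGluing.exists_continuous_density_of_locally' μE μY hMm (fun x => ∀ i, g i x ≠ 0) hK
    (fun a ha => ?_) r hrm hr0 hrc hrC hrK
  -- the inactive thresholds stay non-zero on a neighbourhood of `a`
  set S : Finset ι := Finset.univ.filter fun i => g i a = 0 with hS
  have hSmem : ∀ i, i ∈ S ↔ g i a = 0 := fun i => by simp [hS]
  set N : Set E := ⋂ i ∈ (Sᶜ : Finset ι), interior {x | g i x ≠ 0} with hN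
  have hNo : IsOpen N := isOpen_biInter_finset fun i _ => isOpen_interior
  have haN : a ∈ N := by
    refine mem_iInter₂.2 fun i hi => ?_
    have hgi : g i a ≠ 0 := fun h0 => (Finset.mem_compl.1 hi) ((hSmem i).2 h0)
    exact mem_interior_iff_mem_nhds.2 ((hgc a ha i).preimage_mem_nhds (isOpen_ne.mem_nhds hgi))
  have hNg : ∀ x ∈ N, ∀ i, i ∉ S → g i x ≠ 0 := by
    intro x hx i hi
    have h1 : x ∈ interior {x | g i x ≠ 0} := mem_iInter₂.1 hx i (Finset.mem_compl.2 hi)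
    exact interior_subset h1
  by_cases hact : ∃ i, g i a = 0
  · -- a corner: the finite-family engine for the active sub-family `↥S`
    have hfam := exists_continuousOn_density_map_of_analytic_submersion_sharp_finite (ι := ↥S) μE μY hMm
      (hMan a ha hact) (hsurj a ha) (g := fun i => g i)
      (fun i => (hzero a ha i ((hSmem i).1 i.2)).1) (fun i => (hzero a ha i ((hSmem i).1 i.2)).2)
    obtain ⟨O, hO, haO, D, hD, haD, hH⟩ := hfam
    refine ⟨O ∩ N, D, (hM a ha).continuousAt, hO.inter hNo, ⟨haO, haN⟩, hD, haD, fun r' h1 h2 h3 h4 h5 => ?_⟩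
    obtain ⟨C', hC'⟩ := h4
    refine hH r' h1 h2 (fun x hx hgx => h3 x fun hx' => fun i => ?_) ⟨C', fun x _ => hC' x⟩
      fun x hx => h5 x fun hx' => hx hx'.1
    by_cases hi : i ∈ S
    · exact hgx ⟨i, hi⟩
    · exact hNg x hx'.2 i hi
  · -- no active threshold: the `C¹` engine, window cut down to `N`
    push Not at hact
    obtain ⟨O, hO, haO, D, hD, haD, hH⟩ :=
      SubmersionPushforward.exists_continuousOn_density_map_of_submersion μE μY hMm (hM a ha) (hsurj a ha)
    have hS0 : ∀ i, i ∉ S := fun i hi => hact i ((hSmem i).1 hi)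
    refine ⟨O ∩ N, D, (hM a ha).continuousAt, hO.inter hNo, ⟨haO, haN⟩, hD, haD, fun r' h1 h2 h3 h4 h5 => ?_⟩
    obtain ⟨C', hC'⟩ := h4
    refine hH r' h1 h2 (fun x hx => (h3 x fun hx' => fun i => hNg x hx'.2 i (hS0 i)).continuousWithinAt)
      ⟨C', fun x _ => hC' x⟩ fun x hx => h5 x fun hx' => hx hx'.1

end Literature.MeasureTheory.Integral.AnalyticSubmersion

end
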